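import Summits.HodgeConjecture.CorCM.GaloisTwoPowerOrderFourDescent
import Summits.HodgeConjecture.CorCM.GaloisTwoPowerStructuredNondegenerate
import HarnessLib

/-!
# THE `2`-POWER CLASSIFICATION OF GOOD GALOIS CM FIELDS by induction on the degree: everything follows from degree `32`

COR-CM (cell `pub-hodgecm2`), binder seat b04 (gen 35), count-neutral own lane «Galois-CM-type classification».  KERNEL ONLY:
theorems; no definition, no named fact, no `sorry`.  `HC_CM` is neither used nor claimed.

GOOD = every primitive CM type of the Galois CM field `K` is nondegenerate (the Hodge ring of every power of every simple abelian
variety with CM by `K` is generated by divisor classes).  STRUCT(`K`) = `Gal(K/ℚ) = H·E` with `H.IsComplement' E`, `E` central of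
exponent `2`, `|E| ≤ 2`, complex conjugation `c ∈ H ∖ E`, `|H| = 2^k`, `H` cyclic or `≃ QuaternionGroup (2^(k-2))` — i.e.
`Gal(K/ℚ)` is `C_{2^n}`, `Q_{2^n}`, `C_{2^(n-1)} × C₂` (`c ∈ C`) or `Q_{2^(n-1)} × C₂` (`c ∈ Q`), the conjectured list of GOOD
`2`-power Galois CM fields (all four ARE good: gens 11/15/20/30).  (H2)(`K`) = every `σ ∈ Gal(K/ℚ)` with `σ⁴ = 1` has `σ² ∈ {1, c}`.
Gen 34 (R1, `CorCM/GaloisTwoPowerOrderFourClassification`): GOOD + `[K:ℚ] = 2^n ≥ 64` + (H2) ⟹ STRUCT.  Gen 35 (the descent step,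
`CorCM/GaloisTwoPowerOrderFourDescent`): GOOD + `[K:ℚ] = 2^n ≥ 64` + STRUCT for all GOOD fields of degree `2^(n-1)` ⟹ (H2).  HERE:

* `struct_of_forall_smaller` — the induction step STRUCT(`2^(n-1)`) ⟹ STRUCT(`2^n`) for GOOD fields, `n ≥ 6`.
* **`struct_of_base`** — for any `n₀ ≥ 5`: if every GOOD Galois CM field of degree `2^n₀` is structured, then so is every GOOD
  Galois CM field of degree `2^n`, `n ≥ n₀` (`Nat.le_induction`); `pow_four_sq_of_base` — and (H2) holds from degree `2^(n₀+1)` on.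
* **`struct_of_degree_thirtytwo`** — THE CLASSIFICATION REDUCED TO DEGREE `32`: if every GOOD Galois CM field of degree `32` has
  `Gal ∈ {C₃₂, C₁₆ × C₂, Q₃₂, Q₁₆ × C₂}` (in the STRUCT form; this is exactly what the seat's order-`32` census found, every row of
  it a tree theorem — gens 23/27/28 — but not yet a uniform theorem over all groups of order `32`), then every GOOD Galois CM field
  of degree `2^n ≥ 32` is structured: `Gal(K/ℚ) ∈ {C, Q, C × C₂, Q × C₂}`; `pow_four_sq_of_degree_thirtytwo` — and satisfies (H2).
* **`good_iff_struct_of_degree_thirtytwo`** — with the converse `CorCM/GaloisTwoPowerStructuredNondegenerate` (STRUCT ⟹ GOOD, gens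
  11/15/20/30 packaged): under the degree-`32` hypothesis, for every Galois CM field of degree `2^n ≥ 32`: GOOD ⟺ STRUCT.
* `struct_of_pow_four_sq_sixtyfour` — alternative base: (H2) for GOOD fields of degree `64` suffices for all degrees `2^n ≥ 64`.
* `exists_unstructured_thirtytwo_of_violator` — contrapositive: a GOOD field of degree `2^n ≥ 64` with an (H2)-violator forces a GOOD
  Galois CM field of degree `32` outside the list.
* `struct_of_sq_mem_of_involutions_eq`, **`struct_iff_good_and_sq_mem`** — UNCONDITIONAL reformulation (`2^n ≥ 64`): STRUCT ⟺ GOOD ∧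
  «all squares of `Gal` lie in a subgroup whose only involution is `c`»; so the missing base is exactly «GOOD ⟹ the Frattini
  subgroup `⟨g²⟩` has `c` as its only involution».

## References

* [Shimura1998] G. Shimura, *Abelian Varieties with Complex Multiplication and Modular Functions*, §6.2 Thm. 3, §8.2 Prop. 26, §32.10.
* [Kubota1965] T. Kubota, *On the field extension by complex multiplication*, Trans. AMS 118 (1965), §2 and §4 Lemma 2.
* [Rotman1995] J. J. Rotman, *An Introduction to the Theory of Groups*, 4th ed., GTM 148, Springer 1995, Thm. 5.46.
* [Gordon1999HodgeAVSurvey] B. B. Gordon, *A survey of the Hodge conjecture for abelian varieties*, Thm. 6.4, §9.3, §9.4.3.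
-/

noncomputable section

open CategoryTheory CategoryTheory.Limits NumberField
open scoped BigOperators

namespace Summit.HodgeConjecture.CorCM.GaloisModels

open Literature.NumberTheory.ComplexMultiplication
open Literature.AlgebraicGeometry.Motives (AbelianVariety CMType)
open Literature.AlgebraicGeometry.HodgeTheory
open Literature.AlgebraicGeometry.Pohlmann1968
open Summit.HodgeConjecture.CorCM.GaloisRank

/-- **THE INDUCTION STEP** STRUCT(`2^(n-1)`) ⟹ STRUCT(`2^n`) (`n ≥ 6`): if every GOOD Galois CM field of degree `2^(n-1)` is structured
(`Gal = H·E`, `E` central of exponent `2`, `|E| ≤ 2`, `c ∈ H ∖ E`, `H` cyclic or generalised quaternion), then so is every GOOD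
Galois CM field `K` of degree `2^n` (descent step ⟹ (H2) for `K`; gen 34's (R1) ⟹ STRUCT). [cite: Rotman1995, Thm. 5.46]
[cite: Shimura1998, §8.2 Prop. 26 and §32.10] [cite: Kubota1965, §2 and §4 Lemma 2] -/
theorem struct_of_forall_smaller {K : Type} [Field K] [NumberField K] [IsCMField K] [IsGalois ℚ K] {n : ℕ}
    (hdeg : Module.finrank ℚ K = 2 ^ n) (hn : 6 ≤ n)
    (hgood : ∀ (Φ : CMType K) (φ : K →+* ℂ), IsPrimitive (ℂ ≃+* ℂ) Φ.1 φ → IsNondegenerate Φ)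
    (hS : ∀ (K' : Type) [Field K'] [NumberField K'] [IsCMField K'] [IsGalois ℚ K'],
      Module.finrank ℚ K' = 2 ^ (n - 1) →
      (∀ (Φ : CMType K') (φ : K' →+* ℂ), IsPrimitive (ℂ ≃+* ℂ) Φ.1 φ → IsNondegenerate Φ) →
      ∃ (H E : Subgroup (K' ≃ₐ[ℚ] K')) (k : ℕ), H.IsComplement' E ∧ (IsCMField.complexConj K').restrictScalars ℚ ∈ H ∧
        (IsCMField.complexConj K').restrictScalars ℚ ∉ E ∧ (∀ e ∈ E, e * e = 1 ∧ ∀ g : K' ≃ₐ[ℚ] K', g * e = e * g) ∧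
        Nat.card E ≤ 2 ∧ Nat.card H = 2 ^ k ∧ (IsCyclic H ∨ (3 ≤ k ∧ Nonempty (H ≃* QuaternionGroup (2 ^ (k - 2)))))) :
    ∃ (H E : Subgroup (K ≃ₐ[ℚ] K)) (k : ℕ), H.IsComplement' E ∧ (IsCMField.complexConj K).restrictScalars ℚ ∈ H ∧
      (IsCMField.complexConj K).restrictScalars ℚ ∉ E ∧ (∀ e ∈ E, e * e = 1 ∧ ∀ g : K ≃ₐ[ℚ] K, g * e = e * g) ∧
      Nat.card E ≤ 2 ∧ Nat.card H = 2 ^ k ∧ (IsCyclic H ∨ (3 ≤ k ∧ Nonempty (H ≃* QuaternionGroup (2 ^ (k - 2))))) :=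
  exists_isComplement'_card_le_two_of_forall_isNondegenerate hdeg hn hgood fun σ hσ =>
    sq_eq_one_or_eq_complexConj_of_struct hdeg hn hgood hS σ hσ

/-- **STRUCT IN DEGREE `2^n₀` ⟹ STRUCT IN EVERY DEGREE `2^n`, `n ≥ n₀`** (any `n₀ ≥ 5`): if every GOOD Galois CM field of degree
`2^n₀` has `Gal = H·E` (`E` central of exponent `2`, `|E| ≤ 2`, `c ∈ H ∖ E`, `H` cyclic or generalised quaternion), then so does
every GOOD Galois CM field of degree `2^n` for all `n ≥ n₀`. [cite: Rotman1995, Thm. 5.46] [cite: Shimura1998, §8.2 Prop. 26 and §32.10]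
[cite: Kubota1965, §2 and §4 Lemma 2] -/
theorem struct_of_base {n₀ : ℕ} (hn₀ : 5 ≤ n₀)
    (hbase : ∀ (K : Type) [Field K] [NumberField K] [IsCMField K] [IsGalois ℚ K],
      Module.finrank ℚ K = 2 ^ n₀ →
      (∀ (Φ : CMType K) (φ : K →+* ℂ), IsPrimitive (ℂ ≃+* ℂ) Φ.1 φ → IsNondegenerate Φ) →
      ∃ (H E : Subgroup (K ≃ₐ[ℚ] K)) (k : ℕ), H.IsComplement' E ∧ (IsCMField.complexConj K).restrictScalars ℚ ∈ H ∧
        (IsCMField.complexConj K).restrictScalars ℚ ∉ E ∧ (∀ e ∈ E, e * e = 1 ∧ ∀ g : K ≃ₐ[ℚ] K, g * e = e * g) ∧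
        Nat.card E ≤ 2 ∧ Nat.card H = 2 ^ k ∧ (IsCyclic H ∨ (3 ≤ k ∧ Nonempty (H ≃* QuaternionGroup (2 ^ (k - 2))))))
    {n : ℕ} (hn : n₀ ≤ n) :
    ∀ (K : Type) [Field K] [NumberField K] [IsCMField K] [IsGalois ℚ K],
      Module.finrank ℚ K = 2 ^ n →
      (∀ (Φ : CMType K) (φ : K →+* ℂ), IsPrimitive (ℂ ≃+* ℂ) Φ.1 φ → IsNondegenerate Φ) →
      ∃ (H E : Subgroup (K ≃ₐ[ℚ] K)) (k : ℕ), H.IsComplement' E ∧ (IsCMField.complexConj K).restrictScalars ℚ ∈ H ∧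
        (IsCMField.complexConj K).restrictScalars ℚ ∉ E ∧ (∀ e ∈ E, e * e = 1 ∧ ∀ g : K ≃ₐ[ℚ] K, g * e = e * g) ∧
        Nat.card E ≤ 2 ∧ Nat.card H = 2 ^ k ∧ (IsCyclic H ∨ (3 ≤ k ∧ Nonempty (H ≃* QuaternionGroup (2 ^ (k - 2))))) := by
  induction n, hn using Nat.le_induction with
  | base => exact hbase
  | succ n hn ih =>
    intro K _ _ _ _ hdeg hgood
    exact struct_of_forall_smaller hdeg (by omega) hgood (by rw [Nat.add_sub_cancel]; exact ih)

/-- **(H2) from the base**: under the hypothesis of `struct_of_base` (`n₀ ≥ 5`), every GOOD Galois CM field of degree `2^n` with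
`n > n₀` satisfies «`σ⁴ = 1 ⟹ σ² ∈ {1, c}`». [cite: Shimura1998, §8.2 Prop. 26 and §32.10] [cite: Kubota1965, §2 and §4 Lemma 2] -/
theorem pow_four_sq_of_base {n₀ : ℕ} (hn₀ : 5 ≤ n₀)
    (hbase : ∀ (K : Type) [Field K] [NumberField K] [IsCMField K] [IsGalois ℚ K],
      Module.finrank ℚ K = 2 ^ n₀ →
      (∀ (Φ : CMType K) (φ : K →+* ℂ), IsPrimitive (ℂ ≃+* ℂ) Φ.1 φ → IsNondegenerate Φ) →
      ∃ (H E : Subgroup (K ≃ₐ[ℚ] K)) (k : ℕ), H.IsComplement' E ∧ (IsCMField.complexConj K).restrictScalars ℚ ∈ H ∧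
        (IsCMField.complexConj K).restrictScalars ℚ ∉ E ∧ (∀ e ∈ E, e * e = 1 ∧ ∀ g : K ≃ₐ[ℚ] K, g * e = e * g) ∧
        Nat.card E ≤ 2 ∧ Nat.card H = 2 ^ k ∧ (IsCyclic H ∨ (3 ≤ k ∧ Nonempty (H ≃* QuaternionGroup (2 ^ (k - 2))))))
    {K : Type} [Field K] [NumberField K] [IsCMField K] [IsGalois ℚ K] {n : ℕ} (hdeg : Module.finrank ℚ K = 2 ^ n)
    (hn : n₀ < n) (hgood : ∀ (Φ : CMType K) (φ : K →+* ℂ), IsPrimitive (ℂ ≃+* ℂ) Φ.1 φ → IsNondegenerate Φ)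
    (σ : K ≃ₐ[ℚ] K) (hσ : σ ^ 4 = 1) : σ * σ = 1 ∨ σ * σ = (IsCMField.complexConj K).restrictScalars ℚ :=
  sq_eq_one_or_eq_complexConj_of_struct hdeg (by omega) hgood
    (fun K' _ _ _ _ hd hg => struct_of_base hn₀ hbase (n := n - 1) (by omega) K' hd hg) σ hσ

/-- **THE `2`-POWER CLASSIFICATION, REDUCED TO DEGREE `32`.**  Suppose every Galois CM field of degree `32` all of whose primitive CM
types are nondegenerate has `Gal = H·E`, `E` central of exponent `2`, `|E| ≤ 2`, `c ∈ H ∖ E`, `H` cyclic or generalised quaternion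
(i.e. `Gal ∈ {C₃₂, C₁₆ × C₂, Q₃₂, Q₁₆ × C₂}` with `c` in the first factor — the seat's order-`32` census).  Then every Galois CM field
`K` of degree `2^n`, `n ≥ 5`, all of whose primitive CM types are nondegenerate (the Hodge ring of every power of every simple abelian
variety with CM by `K` is generated by divisor classes) has `Gal(K/ℚ) = H·E` of the same shape: `Gal(K/ℚ)` is `C_{2^n}`, `Q_{2^n}`,
`C_{2^(n-1)} × C₂` or `Q_{2^(n-1)} × C₂` with `c` in the first factor. [cite: Rotman1995, Thm. 5.46]
[cite: Shimura1998, §8.2 Prop. 26 and §18.2] [cite: Gordon1999HodgeAVSurvey, §9.3 and §9.4.3] -/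
theorem struct_of_degree_thirtytwo
    (h32 : ∀ (K : Type) [Field K] [NumberField K] [IsCMField K] [IsGalois ℚ K],
      Module.finrank ℚ K = 32 →
      (∀ (Φ : CMType K) (φ : K →+* ℂ), IsPrimitive (ℂ ≃+* ℂ) Φ.1 φ → IsNondegenerate Φ) →
      ∃ (H E : Subgroup (K ≃ₐ[ℚ] K)) (k : ℕ), H.IsComplement' E ∧ (IsCMField.complexConj K).restrictScalars ℚ ∈ H ∧
        (IsCMField.complexConj K).restrictScalars ℚ ∉ E ∧ (∀ e ∈ E, e * e = 1 ∧ ∀ g : K ≃ₐ[ℚ] K, g * e = e * g) ∧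
        Nat.card E ≤ 2 ∧ Nat.card H = 2 ^ k ∧ (IsCyclic H ∨ (3 ≤ k ∧ Nonempty (H ≃* QuaternionGroup (2 ^ (k - 2))))))
    {K : Type} [Field K] [NumberField K] [IsCMField K] [IsGalois ℚ K] {n : ℕ} (hdeg : Module.finrank ℚ K = 2 ^ n)
    (hn : 5 ≤ n) (hgood : ∀ (Φ : CMType K) (φ : K →+* ℂ), IsPrimitive (ℂ ≃+* ℂ) Φ.1 φ → IsNondegenerate Φ) :
    ∃ (H E : Subgroup (K ≃ₐ[ℚ] K)) (k : ℕ), H.IsComplement' E ∧ (IsCMField.complexConj K).restrictScalars ℚ ∈ H ∧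
      (IsCMField.complexConj K).restrictScalars ℚ ∉ E ∧ (∀ e ∈ E, e * e = 1 ∧ ∀ g : K ≃ₐ[ℚ] K, g * e = e * g) ∧
      Nat.card E ≤ 2 ∧ Nat.card H = 2 ^ k ∧ (IsCyclic H ∨ (3 ≤ k ∧ Nonempty (H ≃* QuaternionGroup (2 ^ (k - 2))))) :=
  struct_of_base (n₀ := 5) le_rfl (fun K _ _ _ _ hd hg => h32 K (by rw [hd]; norm_num) hg) hn K hdeg hgood

/-- **(H2) in every degree `2^n ≥ 64` from the degree-`32` classification.** [cite: Shimura1998, §8.2 Prop. 26 and §32.10]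
[cite: Kubota1965, §2 and §4 Lemma 2] -/
theorem pow_four_sq_of_degree_thirtytwo
    (h32 : ∀ (K : Type) [Field K] [NumberField K] [IsCMField K] [IsGalois ℚ K],
      Module.finrank ℚ K = 32 →
      (∀ (Φ : CMType K) (φ : K →+* ℂ), IsPrimitive (ℂ ≃+* ℂ) Φ.1 φ → IsNondegenerate Φ) →
      ∃ (H E : Subgroup (K ≃ₐ[ℚ] K)) (k : ℕ), H.IsComplement' E ∧ (IsCMField.complexConj K).restrictScalars ℚ ∈ H ∧
        (IsCMField.complexConj K).restrictScalars ℚ ∉ E ∧ (∀ e ∈ E, e * e = 1 ∧ ∀ g : K ≃ₐ[ℚ] K, g * e = e * g) ∧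
        Nat.card E ≤ 2 ∧ Nat.card H = 2 ^ k ∧ (IsCyclic H ∨ (3 ≤ k ∧ Nonempty (H ≃* QuaternionGroup (2 ^ (k - 2))))))
    {K : Type} [Field K] [NumberField K] [IsCMField K] [IsGalois ℚ K] {n : ℕ} (hdeg : Module.finrank ℚ K = 2 ^ n)
    (hn : 6 ≤ n) (hgood : ∀ (Φ : CMType K) (φ : K →+* ℂ), IsPrimitive (ℂ ≃+* ℂ) Φ.1 φ → IsNondegenerate Φ)
    (σ : K ≃ₐ[ℚ] K) (hσ : σ ^ 4 = 1) : σ * σ = 1 ∨ σ * σ = (IsCMField.complexConj K).restrictScalars ℚ :=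
  pow_four_sq_of_base (n₀ := 5) le_rfl (fun K _ _ _ _ hd hg => h32 K (by rw [hd]; norm_num) hg) hdeg (by omega) hgood σ hσ

/-- **Alternative base: (H2) in degree `64`.**  If every GOOD Galois CM field of degree `64` satisfies «`σ⁴ = 1 ⟹ σ² ∈ {1, c}`», then
every GOOD Galois CM field of degree `2^n`, `n ≥ 6`, is structured (`Gal ∈ {C, Q, C × C₂, Q × C₂}`). [cite: Rotman1995, Thm. 5.46]
[cite: Shimura1998, §8.2 Prop. 26 and §18.2] -/
theorem struct_of_pow_four_sq_sixtyfour
    (h64 : ∀ (K : Type) [Field K] [NumberField K] [IsCMField K] [IsGalois ℚ K],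
      Module.finrank ℚ K = 2 ^ 6 →
      (∀ (Φ : CMType K) (φ : K →+* ℂ), IsPrimitive (ℂ ≃+* ℂ) Φ.1 φ → IsNondegenerate Φ) →
      ∀ σ : K ≃ₐ[ℚ] K, σ ^ 4 = 1 → σ * σ = 1 ∨ σ * σ = (IsCMField.complexConj K).restrictScalars ℚ)
    {K : Type} [Field K] [NumberField K] [IsCMField K] [IsGalois ℚ K] {n : ℕ} (hdeg : Module.finrank ℚ K = 2 ^ n)
    (hn : 6 ≤ n) (hgood : ∀ (Φ : CMType K) (φ : K →+* ℂ), IsPrimitive (ℂ ≃+* ℂ) Φ.1 φ → IsNondegenerate Φ) :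
    ∃ (H E : Subgroup (K ≃ₐ[ℚ] K)) (k : ℕ), H.IsComplement' E ∧ (IsCMField.complexConj K).restrictScalars ℚ ∈ H ∧
      (IsCMField.complexConj K).restrictScalars ℚ ∉ E ∧ (∀ e ∈ E, e * e = 1 ∧ ∀ g : K ≃ₐ[ℚ] K, g * e = e * g) ∧
      Nat.card E ≤ 2 ∧ Nat.card H = 2 ^ k ∧ (IsCyclic H ∨ (3 ≤ k ∧ Nonempty (H ≃* QuaternionGroup (2 ^ (k - 2))))) :=
  struct_of_base (n₀ := 6) (by norm_num)
    (fun K _ _ _ _ hd hg => exists_isComplement'_card_le_two_of_forall_isNondegenerate hd le_rfl hg (h64 K hd hg)) hn K hdeg hgood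

/-- **Contrapositive**: an (H2)-violator `y` (`y⁴ = 1`, `y² ∉ {1, c}`) in a GOOD Galois CM field of degree `2^n ≥ 64` forces a GOOD
Galois CM field of degree `32` whose Galois group is NOT of the form `H·E` (`E` central of exponent `2`, `|E| ≤ 2`, `c ∈ H ∖ E`,
`H` cyclic or generalised quaternion) — i.e. a counterexample to the order-`32` census. [cite: Shimura1998, §8.2 Prop. 26 and §32.10]
[cite: Kubota1965, §2 and §4 Lemma 2] -/
theorem exists_unstructured_thirtytwo_of_violator {K : Type} [Field K] [NumberField K] [IsCMField K] [IsGalois ℚ K] {n : ℕ}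
    (hdeg : Module.finrank ℚ K = 2 ^ n) (hn : 6 ≤ n)
    (hgood : ∀ (Φ : CMType K) (φ : K →+* ℂ), IsPrimitive (ℂ ≃+* ℂ) Φ.1 φ → IsNondegenerate Φ)
    (y : K ≃ₐ[ℚ] K) (hy4 : y ^ 4 = 1) (hy1 : y * y ≠ 1) (hyc : y * y ≠ (IsCMField.complexConj K).restrictScalars ℚ) :
    ∃ (L : Type) (_ : Field L) (_ : NumberField L) (_ : IsCMField L) (_ : IsGalois ℚ L),
      Module.finrank ℚ L = 32 ∧ (∀ (Φ : CMType L) (φ : L →+* ℂ), IsPrimitive (ℂ ≃+* ℂ) Φ.1 φ → IsNondegenerate Φ) ∧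
      ¬ ∃ (H E : Subgroup (L ≃ₐ[ℚ] L)) (k : ℕ), H.IsComplement' E ∧ (IsCMField.complexConj L).restrictScalars ℚ ∈ H ∧
        (IsCMField.complexConj L).restrictScalars ℚ ∉ E ∧ (∀ e ∈ E, e * e = 1 ∧ ∀ g : L ≃ₐ[ℚ] L, g * e = e * g) ∧
        Nat.card E ≤ 2 ∧ Nat.card H = 2 ^ k ∧ (IsCyclic H ∨ (3 ≤ k ∧ Nonempty (H ≃* QuaternionGroup (2 ^ (k - 2))))) := by
  by_contra hne
  push Not at hne
  have h32 : ∀ (L : Type) [Field L] [NumberField L] [IsCMField L] [IsGalois ℚ L], Module.finrank ℚ L = 32 →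
      (∀ (Φ : CMType L) (φ : L →+* ℂ), IsPrimitive (ℂ ≃+* ℂ) Φ.1 φ → IsNondegenerate Φ) →
      ∃ (H E : Subgroup (L ≃ₐ[ℚ] L)) (k : ℕ), H.IsComplement' E ∧ (IsCMField.complexConj L).restrictScalars ℚ ∈ H ∧
        (IsCMField.complexConj L).restrictScalars ℚ ∉ E ∧ (∀ e ∈ E, e * e = 1 ∧ ∀ g : L ≃ₐ[ℚ] L, g * e = e * g) ∧
        Nat.card E ≤ 2 ∧ Nat.card H = 2 ^ k ∧ (IsCyclic H ∨ (3 ≤ k ∧ Nonempty (H ≃* QuaternionGroup (2 ^ (k - 2))))) :=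
    fun L _ _ _ _ hL hgoodL => hne L inferInstance inferInstance inferInstance inferInstance hL hgoodL
  rcases pow_four_sq_of_degree_thirtytwo h32 hdeg hn hgood y hy4 with h | h
  · exact hy1 h
  · exact hyc h

/-- **THE `2`-POWER CLASSIFICATION AS AN EQUIVALENCE (modulo degree `32`).**  If every GOOD Galois CM field of degree `32` is structured,
then for every Galois CM field `K` of degree `2^n`, `n ≥ 5`: every primitive CM type of `K` is nondegenerate (the Hodge ring of every
power of every simple abelian variety with CM by `K` is generated by divisor classes) **if and only if** `Gal(K/ℚ) = H·E` with
`H.IsComplement' E`, `E` central of exponent `2`, `|E| ≤ 2`, `c ∈ H ∖ E`, `H` cyclic or generalised quaternion — i.e. iff `Gal(K/ℚ)` is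
`C_{2^n}`, `Q_{2^n}`, `C_{2^(n-1)} × C₂` (`c ∈ C`) or `Q_{2^(n-1)} × C₂` (`c ∈ Q`). [cite: Rotman1995, Thm. 5.46]
[cite: Kubota1965, §2 and §4 Lemma 2] [cite: Shimura1998, §8.2 Prop. 26 and §18.2] [cite: Gordon1999HodgeAVSurvey, §9.3 and §9.4.3] -/
theorem good_iff_struct_of_degree_thirtytwo
    (h32 : ∀ (K : Type) [Field K] [NumberField K] [IsCMField K] [IsGalois ℚ K],
      Module.finrank ℚ K = 32 →
      (∀ (Φ : CMType K) (φ : K →+* ℂ), IsPrimitive (ℂ ≃+* ℂ) Φ.1 φ → IsNondegenerate Φ) →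
      ∃ (H E : Subgroup (K ≃ₐ[ℚ] K)) (k : ℕ), H.IsComplement' E ∧ (IsCMField.complexConj K).restrictScalars ℚ ∈ H ∧
        (IsCMField.complexConj K).restrictScalars ℚ ∉ E ∧ (∀ e ∈ E, e * e = 1 ∧ ∀ g : K ≃ₐ[ℚ] K, g * e = e * g) ∧
        Nat.card E ≤ 2 ∧ Nat.card H = 2 ^ k ∧ (IsCyclic H ∨ (3 ≤ k ∧ Nonempty (H ≃* QuaternionGroup (2 ^ (k - 2))))))
    {K : Type} [Field K] [NumberField K] [IsCMField K] [IsGalois ℚ K] {n : ℕ} (hdeg : Module.finrank ℚ K = 2 ^ n)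
    (hn : 5 ≤ n) :
    (∀ (Φ : CMType K) (φ : K →+* ℂ), IsPrimitive (ℂ ≃+* ℂ) Φ.1 φ → IsNondegenerate Φ) ↔
      ∃ (H E : Subgroup (K ≃ₐ[ℚ] K)) (k : ℕ), H.IsComplement' E ∧ (IsCMField.complexConj K).restrictScalars ℚ ∈ H ∧
        (IsCMField.complexConj K).restrictScalars ℚ ∉ E ∧ (∀ e ∈ E, e * e = 1 ∧ ∀ g : K ≃ₐ[ℚ] K, g * e = e * g) ∧
        Nat.card E ≤ 2 ∧ Nat.card H = 2 ^ k ∧ (IsCyclic H ∨ (3 ≤ k ∧ Nonempty (H ≃* QuaternionGroup (2 ^ (k - 2))))) := by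
  refine ⟨fun hgood => struct_of_degree_thirtytwo h32 hdeg hn hgood, ?_⟩
  rintro ⟨H, E, k, hHE, hcH, -, hE, hEcard, hHcard, hstruct⟩ Φ φ hprim
  exact isNondegenerate_of_isPrimitive_of_struct hdeg (by omega) H E k hHE hcH hE hEcard hHcard hstruct φ hprim

/-! ## An unconditional reformulation of the base -/

/-- **Squares inside a subgroup whose only involution is `c` ⟹ STRUCT** (unconditional, `[K:ℚ] = 2^n ≥ 64`): if every square `g²`
of `Gal(K/ℚ)` lies in a subgroup `S` all of whose involutions equal complex conjugation `c`, then (H2) holds trivially and gen 34's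
(R1) structures `Gal(K/ℚ)`.  (So the degree-`32`/`64` base of the classification is equivalent to: GOOD ⟹ the Frattini subgroup
`⟨g²⟩` of `Gal(K/ℚ)` has `c` as its only involution.) [cite: Rotman1995, Thm. 5.46] [cite: Shimura1998, §8.2 Prop. 26 and §18.2] -/
theorem struct_of_sq_mem_of_involutions_eq {K : Type} [Field K] [NumberField K] [IsCMField K] [IsGalois ℚ K] {n : ℕ}
    (hdeg : Module.finrank ℚ K = 2 ^ n) (hn : 6 ≤ n)
    (hgood : ∀ (Φ : CMType K) (φ : K →+* ℂ), IsPrimitive (ℂ ≃+* ℂ) Φ.1 φ → IsNondegenerate Φ) (S : Subgroup (K ≃ₐ[ℚ] K))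
    (hsq : ∀ g : K ≃ₐ[ℚ] K, g * g ∈ S)
    (hS : ∀ s ∈ S, s * s = 1 → s ≠ 1 → s = (IsCMField.complexConj K).restrictScalars ℚ) :
    ∃ (H E : Subgroup (K ≃ₐ[ℚ] K)) (k : ℕ), H.IsComplement' E ∧ (IsCMField.complexConj K).restrictScalars ℚ ∈ H ∧
      (IsCMField.complexConj K).restrictScalars ℚ ∉ E ∧ (∀ e ∈ E, e * e = 1 ∧ ∀ g : K ≃ₐ[ℚ] K, g * e = e * g) ∧
      Nat.card E ≤ 2 ∧ Nat.card H = 2 ^ k ∧ (IsCyclic H ∨ (3 ≤ k ∧ Nonempty (H ≃* QuaternionGroup (2 ^ (k - 2))))) := by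
  refine exists_isComplement'_card_le_two_of_forall_isNondegenerate hdeg hn hgood fun σ hσ => ?_
  by_cases h1 : σ * σ = 1
  · exact Or.inl h1
  · refine Or.inr (hS _ (hsq σ) ?_ h1)
    rw [show σ * σ * (σ * σ) = σ ^ 4 by simp only [pow_succ, pow_zero, one_mul, mul_assoc]]
    exact hσ

/-- **STRUCT ⟺ GOOD ∧ (squares in a subgroup with `c` as only involution)**, unconditionally for `[K:ℚ] = 2^n ≥ 64`: the structured
fields are exactly the GOOD fields whose Galois group has all its squares inside a subgroup whose only involution is complex
conjugation (for `Gal = H·E` that subgroup is `H`: `(h e)² = h²`). [cite: Rotman1995, Thm. 5.46] [cite: Kubota1965, §2 and §4 Lemma 2]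
[cite: Shimura1998, §8.2 Prop. 26 and §18.2] -/
theorem struct_iff_good_and_sq_mem {K : Type} [Field K] [NumberField K] [IsCMField K] [IsGalois ℚ K] {n : ℕ}
    (hdeg : Module.finrank ℚ K = 2 ^ n) (hn : 6 ≤ n) :
    (∃ (H E : Subgroup (K ≃ₐ[ℚ] K)) (k : ℕ), H.IsComplement' E ∧ (IsCMField.complexConj K).restrictScalars ℚ ∈ H ∧
      (IsCMField.complexConj K).restrictScalars ℚ ∉ E ∧ (∀ e ∈ E, e * e = 1 ∧ ∀ g : K ≃ₐ[ℚ] K, g * e = e * g) ∧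
      Nat.card E ≤ 2 ∧ Nat.card H = 2 ^ k ∧ (IsCyclic H ∨ (3 ≤ k ∧ Nonempty (H ≃* QuaternionGroup (2 ^ (k - 2)))))) ↔
    ((∀ (Φ : CMType K) (φ : K →+* ℂ), IsPrimitive (ℂ ≃+* ℂ) Φ.1 φ → IsNondegenerate Φ) ∧
      ∃ S : Subgroup (K ≃ₐ[ℚ] K), (∀ g : K ≃ₐ[ℚ] K, g * g ∈ S) ∧
        ∀ s ∈ S, s * s = 1 → s ≠ 1 → s = (IsCMField.complexConj K).restrictScalars ℚ) := by
  classical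
  constructor
  · rintro ⟨H, E, k, hHE, hcH, hcE, hE, hEcard, hHcard, hstruct⟩
    refine ⟨fun Φ φ hprim => isNondegenerate_of_isPrimitive_of_struct hdeg (by omega) H E k hHE hcH hE hEcard hHcard hstruct φ hprim,
      H, fun g => ?_, ?_⟩
    · -- `g = h e`, `g² = h² ∈ H`
      obtain ⟨⟨h, e⟩, hhe⟩ := hHE.2 g
      change (h : K ≃ₐ[ℚ] K) * e = g at hhe
      rw [← hhe]
      have heh : (h : K ≃ₐ[ℚ] K) * e = e * h := (hE e e.2).2 h
      have : (h : K ≃ₐ[ℚ] K) * e * (h * e) = h * h * (e * e) := by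
        calc (h : K ≃ₐ[ℚ] K) * e * (h * e) = h * (e * h) * e := by group
          _ = h * (h * e) * e := by rw [← heh]
          _ = h * h * (e * e) := by group
      rw [this, (hE e e.2).1, mul_one]
      exact H.mul_mem h.2 h.2
    · -- the only involution of `H` is `c`
      set c := (IsCMField.complexConj K).restrictScalars ℚ with hc
      have hcc : c * c = 1 := model_complexConj_mul_self (MulEquiv.refl (K ≃ₐ[ℚ] K)) (by simp [hc])
      have hc1 : c ≠ 1 := model_complexConj_ne_one (MulEquiv.refl (K ≃ₐ[ℚ] K)) (by simp [hc])
      rcases hstruct with hcyc | ⟨-, ⟨f⟩⟩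
      · obtain ⟨gH, hgH⟩ := IsCyclic.exists_generator (α := H)
        have hog : orderOf (gH : K ≃ₐ[ℚ] K) = 2 ^ k := by
          rw [Subgroup.orderOf_coe, orderOf_eq_card_of_forall_mem_zpowers hgH, hHcard]
        have hmem : ∀ s : K ≃ₐ[ℚ] K, s ∈ H → s ∈ Subgroup.zpowers (gH : K ≃ₐ[ℚ] K) := by
          intro s hs
          obtain ⟨i, hi⟩ := Subgroup.mem_zpowers_iff.1 (hgH ⟨s, hs⟩)
          exact Subgroup.mem_zpowers_iff.2 ⟨i, by rw [← Subgroup.coe_zpow, hi]⟩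
        intro s hs hss hs1
        exact involution_eq_of_mem_zpowers hog (hmem s hs) hss hs1 (hmem c hcH) hcc hc1
      · haveI : NeZero (2 ^ (k - 2)) := ⟨by positivity⟩
        obtain ⟨a', -, -, -, -, -, -, -, hinvol⟩ := exists_index_two_data_of_mulEquiv_quaternionGroup H f
        intro s hs hss hs1
        rw [hinvol s hs hss hs1, ← hinvol c hcH hcc hc1]
  · rintro ⟨hgood, S, hsq, hS⟩
    exact struct_of_sq_mem_of_involutions_eq hdeg hn hgood S hsq hS

end Summit.HodgeConjecture.CorCM.GaloisModels
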